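import Summits.QuantumFields.YangMills.Theorems.BalabanLadderUVSeamRecCeilingsResponseCarriersLocal
import Summits.QuantumFields.YangMills.Theorems.BalabanLadderUVSeamRecPolymerCarrierFolding
import Summits.QuantumFields.YangMills.Theorems.BalabanLadderNTBoundaryLawCore
import HarnessLib

/-!
# Crux `UVSeamRec` (stmt-QuantumFields-20043), v5(α) stub `stub_responseMomentsOdd6` (RM): the SEAM REDUCTION — the (RM) body depends on the
# cube centres only modulo the torus period, so carrier moment bounds are needed for REDUCED centres `|x_i| ≤ L` only

Helper file (`--supports stmt-QuantumFields-20043`) of the width-lever seat `ym-20043-ceilings-p2` (lane B, gen 3); a variant of g2's carriers engine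
p541829 `responseMoments_of_carriers_local`.  WHY.  The registered (RM) body quantifies over cube centres `x : Fin n → ℤ⁴` with a CYCLIC separation
guard, i.e. over all `ℤ⁴`-representatives of torus positions, while tempered-d1's large-field carrier `influenceAt 𝔟 ε kmax β R q x` reads the blocks
of the GLOBAL grid `b^kℤ⁴` around the representative `x` — and on a torus of side `2L+1` not divisible by `b^k` the grids seen from two representatives
of cyclically close centres are MISALIGNED by `(2L+1) mod b^k` (the «seam»): the family shell then contains pairs of distinct same-level block-plaquettes
with heavily OVERLAPPING torus footprints, for which no product law with small weights can hold (`μ(E ∩ E') ≈ μ(E)`).  This is the collar-scale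
divisibility obstruction at prime sides, located inside lane B's own currency (note LANE-B-g3 §7).  The cure has two halves: (i) THIS FILE — the
response body `kerE_{x−(R+1),2R+3}(lift U)(plane q x)` is invariant under `x ↦ x + (2L+1)v` (translation covariance of the DLR kernel,
`NT.BoundaryLaw.kerE_plane_configShift`, and periodicity of the lift), so the carriers engine needs the carrier moment bounds only for REDUCED families
(`|x i c| ≤ L`, representatives `valMinAbs`); (ii) the sequel `…CeilingsWindowCellLaws` — for reduced families the seam conflicts are confined to the
`16` sign classes of the anchors, and WINDOW cell laws (no wrap) give the per-level laws with weights `δ_k^{1/16}`.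

* §1 `configShift_torusLift_of_dvd`, `kerE_plane_torusLift_eq_of_congr` — periodicity and covariance.
* §2 `responseMoments_of_carriers_local_reduced` — p541829's engine with the K-fold moment hypotheses asked only for reduced centres; conclusion (RM)
  for ALL centres.  `responseMoments_of_quadratic_and_reducedLF` — the two-carrier instance: (split) ∀η + (EM_Q) + a doubled joint exponential moment
  bound for the large-field carrier on REDUCED separated families ⇒ (RM) with `B = A₀ + max(B_Q, B_LF)`.

HONEST FRAMING: composition; nothing of E0′; not a gap, not Clay.
References: H.-O. Georgii, *Gibbs Measures and Phase Transitions* (2011) (5.3)–(5.4), Thm. 4.17 (translation covariance / DLR, via the tree's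
`kerE_configShift`); folklore.
-/

set_option autoImplicit false

noncomputable section

open MeasureTheory Filter Topology Finset
open Literature.Probability.LatticeModels
open Literature.MathematicalPhysics.QuantumFieldTheory (GaugeConfig wilsonMeasure isProbabilityMeasure_wilsonMeasure
  measurable_torusLift LatticeRep)
open Literature.MathematicalPhysics.QuantumLattice

namespace Summit.QuantumFields.YangMills.Cruxes.UVSeamRec.TemperedResponse

open Summit.QuantumFields.YangMills.Cruxes.OSLegsFromFemtoAndGap.DlrCollarTransfer
open Summit.QuantumFields.YangMills.Cruxes.UVSeamRec.PolymerData (abs_valMinAbs_le dvd_sub_valMinAbs)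
open Summit.QuantumFields.YangMills.Cruxes.NT.BoundaryLaw (kerE_plane_configShift)

/-! ## §1 Periodicity of the lift and covariance of the response body -/

section Periodicity

variable {G : Type} [MeasurableSpace G]

/-- The periodic lift of a torus configuration is invariant under translations by periods. [folklore] -/
theorem configShift_torusLift_of_dvd (L : ℕ) (v : Fin 4 → ℤ) (hv : ∀ c, ((2 * L + 1 : ℕ) : ℤ) ∣ v c)
    (U : GaugeConfig 4 (2 * L + 1) G) :
    configShift v (torusLift (2 * L + 1) U) = torusLift (2 * L + 1) U := by
  funext e
  rw [Literature.MathematicalPhysics.QuantumLattice.configShift_apply]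
  simp only [torusLift, Function.comp_apply, torusEdge]
  congr 2
  funext c
  simp only [Torus.proj_apply, Pi.sub_apply, Int.cast_sub]
  rw [(ZMod.intCast_zmod_eq_zero_iff_dvd (v c) (2 * L + 1)).2 (hv c), sub_zero]

end Periodicity

section Covariance

variable {G : Type} [Group G] [TopologicalSpace G] [IsTopologicalGroup G] [CompactSpace G]
  [MeasurableSpace G] [BorelSpace G] (r : LatticeRep G)

/-- **The response body sees the cube centre only modulo the period.**  If `x ≡ x' (mod 2L+1)` coordinatewise, the kernel mean of `plane q x` in
the radius-`(R+1)` cube around `x` with exterior `lift U` equals that of `plane q x'` around `x'` (translation covariance of the DLR kernel +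
periodicity of the lift). [folklore] -/
theorem kerE_plane_torusLift_eq_of_congr (β : ℝ) (L R : ℕ) (q : Fin 4 × Fin 4) (x x' : Fin 4 → ℤ)
    (h : ∀ c, ((2 * L + 1 : ℕ) : ℤ) ∣ x c - x' c) (U : GaugeConfig 4 (2 * L + 1) G) :
    kerE G r β (fun k => x k - (R + 1)) (2 * R + 3) (torusLift (2 * L + 1) U) (plane G r q x) =
      kerE G r β (fun k => x' k - (R + 1)) (2 * R + 3) (torusLift (2 * L + 1) U) (plane G r q x') := by
  have hv := configShift_torusLift_of_dvd L (x - x') (fun c => by simpa using h c) U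
  have key := kerE_plane_configShift G r (x - x') β (fun k => x' k - (R + 1)) (2 * R + 3) (torusLift (2 * L + 1) U) q x'
  have h1 : ((fun k => x' k - ((R : ℤ) + 1)) + (x - x')) = fun k => x k - ((R : ℤ) + 1) := by
    funext k
    simp only [Pi.add_apply, Pi.sub_apply]
    ring
  have h2 : x' + (x - x') = x := by
    funext k
    simp only [Pi.add_apply, Pi.sub_apply]
    ring
  calc kerE G r β (fun k => x k - (R + 1)) (2 * R + 3) (torusLift (2 * L + 1) U) (plane G r q x)
      = kerE G r β ((fun k => x' k - ((R : ℤ) + 1)) + (x - x')) (2 * R + 3)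
          (configShift (x - x') (torusLift (2 * L + 1) U)) (plane G r q (x' + (x - x'))) := by
        rw [hv, h1, h2]
    _ = kerE G r β (fun k => x' k - (R + 1)) (2 * R + 3) (torusLift (2 * L + 1) U) (plane G r q x') := key

end Covariance

/-! ## §2 The carriers engine with moment bounds on REDUCED families only -/

section Engine

variable {G : Type} [Group G] [TopologicalSpace G] [IsTopologicalGroup G] [CompactSpace G]
  [MeasurableSpace G] [BorelSpace G] (r : LatticeRep G) (a : ℝ → ℝ)

/-- **(RM) from CARRIERS, with the K-fold moment bounds asked only for REDUCED cube families.**  As p541829's `responseMoments_of_carriers_local`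
(measurable carriers `Y k β R q x` bounded by `MY β R q x`; (split) for every exterior; conclusion (RM) with `B = A₀ + B'`), except that the
hypothesis (EM_K) `⟨exp(K·Σ_{i∈T} Y k β R (q i) (x i)∘lift)⟩_{2L+1,β} ≤ exp(B'·#T)` is asked only for families with `|x i c| ≤ L` for all `i, c`
(representatives in the fundamental box).  Proof: replace `x` by its `valMinAbs` representatives `x'`; the cyclic guard is unchanged and the (RM)
integrand at `x` equals the one at `x'` (`kerE_plane_torusLift_eq_of_congr`); then the pointwise split and AM–GM as in p541829. [folklore] -/
theorem responseMoments_of_carriers_local_reduced {K : ℕ} (hK : 0 < K) {C₁ β₁ ℓ₁ A₀ B' : ℝ} {p : Fin 4 × Fin 4 → ℝ → ℝ}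
    (Y : Fin K → ℝ → ℕ → Fin 4 × Fin 4 → (Fin 4 → ℤ) → LGConfig 4 G → ℝ) (MY : ℝ → ℕ → Fin 4 × Fin 4 → (Fin 4 → ℤ) → ℝ)
    (hYm : ∀ k β R q x, Measurable (Y k β R q x)) (hYb : ∀ k β R q x η, |Y k β R q x η| ≤ MY β R q x)
    (hsplit : ∀ β : ℝ, β₁ ≤ β → ∀ R : ℕ, 1 ≤ R → (R : ℝ) * a β ≤ ℓ₁ →
      ∀ (q : Fin 4 × Fin 4) (x : Fin 4 → ℤ), q.1 < q.2 → ∀ η : LGConfig 4 G,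
        (R : ℝ) ^ 4 / C₁ * |kerE G r β (fun k => x k - (R + 1)) (2 * R + 3) η (plane G r q x) - p q β| ≤
          A₀ + ∑ k, Y k β R q x η)
    (hEM : ∀ k : Fin K, ∀ β : ℝ, β₁ ≤ β → ∀ (L n : ℕ) (q : Fin n → Fin 4 × Fin 4) (x : Fin n → (Fin 4 → ℤ)) (R : ℕ),
      (∀ i, (q i).1 < (q i).2) → 1 ≤ R → (R : ℝ) * a β ≤ ℓ₁ → 4 * R + 8 ≤ L →
      (∀ i c, |x i c| ≤ (L : ℤ)) →
      (∀ i j : Fin n, i ≠ j → ∃ k : Fin 4,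
        (2 * (R : ℤ) + 4) ≤ |((((x i k - x j k : ℤ) : ZMod (2 * L + 1))).valMinAbs : ℤ)|) →
      ∀ T : Finset (Fin n),
        torusE G r β L (fun U => Real.exp ((K : ℝ) * ∑ i ∈ T, Y k β R (q i) (x i) U)) ≤ Real.exp (B' * T.card)) :
    ∀ β : ℝ, β₁ ≤ β → ∀ (L n : ℕ) (q : Fin n → Fin 4 × Fin 4) (x : Fin n → (Fin 4 → ℤ)) (R : ℕ),
      (∀ i, (q i).1 < (q i).2) → 1 ≤ R → (R : ℝ) * a β ≤ ℓ₁ → 4 * R + 8 ≤ L →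
      (∀ i j : Fin n, i ≠ j → ∃ k : Fin 4,
        (2 * (R : ℤ) + 4) ≤ |((((x i k - x j k : ℤ) : ZMod (2 * L + 1))).valMinAbs : ℤ)|) →
      ∀ T : Finset (Fin n),
        torusE G r β L (fun U => Real.exp (∑ i ∈ T, (R : ℝ) ^ 4 / C₁ *
          |kerE G r β (fun k => x i k - (R + 1)) (2 * R + 3) U (plane G r (q i) (x i)) - p (q i) β|)) ≤
          Real.exp ((A₀ + B') * T.card) := by
  intro β hβ L n q x R hq hR hRa hRL hsep T
  haveI := isProbabilityMeasure_wilsonMeasure (d := 4) (L := 2 * L + 1) r.ρ r.continuous β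
  -- the reduced representatives
  set x' : Fin n → (Fin 4 → ℤ) := fun i c => (((x i c : ℤ) : ZMod (2 * L + 1)).valMinAbs : ℤ) with hx'
  have hx'abs : ∀ i c, |x' i c| ≤ (L : ℤ) := fun i c => abs_valMinAbs_le L (x i c)
  have hdvd : ∀ i c, ((2 * L + 1 : ℕ) : ℤ) ∣ x i c - x' i c := fun i c => dvd_sub_valMinAbs L (x i c)
  have hsep' : ∀ i j : Fin n, i ≠ j → ∃ k : Fin 4,
      (2 * (R : ℤ) + 4) ≤ |((((x' i k - x' j k : ℤ) : ZMod (2 * L + 1))).valMinAbs : ℤ)| := by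
    intro i j hij
    obtain ⟨k, hk⟩ := hsep i j hij
    refine ⟨k, ?_⟩
    have hcast : ((x' i k - x' j k : ℤ) : ZMod (2 * L + 1)) = ((x i k - x j k : ℤ) : ZMod (2 * L + 1)) := by
      simp only [hx', Int.cast_sub, ZMod.coe_valMinAbs]
    rw [hcast]
    exact hk
  -- the (RM) integrand at `x` is the one at `x'`
  have hbody : ∀ (U : GaugeConfig 4 (2 * L + 1) G) (i : Fin n),
      kerE G r β (fun k => x i k - (R + 1)) (2 * R + 3) (torusLift (2 * L + 1) U) (plane G r (q i) (x i)) =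
        kerE G r β (fun k => x' i k - (R + 1)) (2 * R + 3) (torusLift (2 * L + 1) U) (plane G r (q i) (x' i)) :=
    fun U i => kerE_plane_torusLift_eq_of_congr r β L R (q i) (x i) (x' i) (hdvd i) U
  -- the carriers read on the torus, at the reduced centres
  set Z : Fin K → GaugeConfig 4 (2 * L + 1) G → ℝ :=
    fun k U => ∑ i ∈ T, Y k β R (q i) (x' i) (torusLift (2 * L + 1) U) with hZdef
  have hZm : ∀ k, Measurable (Z k) := fun k =>
    Finset.measurable_sum T fun i _ => (hYm k β R (q i) (x' i)).comp (measurable_torusLift _)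
  have hZb : ∀ k U, |Z k U| ≤ ∑ i ∈ T, MY β R (q i) (x' i) := fun k U => by
    rw [hZdef]
    exact (Finset.abs_sum_le_sum_abs _ _).trans (Finset.sum_le_sum fun i _ => hYb k β R (q i) (x' i) _)
  have hint : ∀ k, Integrable (fun U => Real.exp ((K : ℝ) * Z k U))
      (wilsonMeasure (d := 4) (L := 2 * L + 1) r.ρ β) := fun k => by
    refine integrable_of_abs_le ((hZm k).const_mul _).exp (C := Real.exp ((K : ℝ) * ∑ i ∈ T, MY β R (q i) (x' i)))
      fun U => ?_
    rw [Real.abs_exp]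
    exact Real.exp_le_exp.2 (mul_le_mul_of_nonneg_left ((le_abs_self _).trans (hZb k U)) (Nat.cast_nonneg _))
  -- the K-fold moment bounds at the reduced family
  have hM : ∀ k, ∫ U, Real.exp ((K : ℝ) * Z k U) ∂(wilsonMeasure (d := 4) (L := 2 * L + 1) r.ρ β) ≤
      Real.exp (B' * T.card) := fun k => by
    have h := hEM k β hβ L n q x' R hq hR hRa hRL hx'abs hsep' T
    simpa only [torusE, hZdef] using h
  have havg := integral_exp_sum_le_of_forall (wilsonMeasure (d := 4) (L := 2 * L + 1) r.ρ β) hK Z hint hM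
  -- pointwise split at the reduced centres, summed over `T`
  have hsplit' : ∀ U : GaugeConfig 4 (2 * L + 1) G,
      Real.exp (∑ i ∈ T, (R : ℝ) ^ 4 / C₁ *
        |kerE G r β (fun k => x i k - (R + 1)) (2 * R + 3) (torusLift (2 * L + 1) U) (plane G r (q i) (x i)) -
          p (q i) β|) ≤ Real.exp (A₀ * T.card) * Real.exp (∑ k, Z k U) := fun U => by
    rw [← Real.exp_add]
    refine Real.exp_le_exp.2 ?_
    calc ∑ i ∈ T, (R : ℝ) ^ 4 / C₁ *
          |kerE G r β (fun k => x i k - (R + 1)) (2 * R + 3) (torusLift (2 * L + 1) U) (plane G r (q i) (x i)) -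
            p (q i) β|
        = ∑ i ∈ T, (R : ℝ) ^ 4 / C₁ *
          |kerE G r β (fun k => x' i k - (R + 1)) (2 * R + 3) (torusLift (2 * L + 1) U) (plane G r (q i) (x' i)) -
            p (q i) β| := Finset.sum_congr rfl fun i _ => by rw [hbody U i]
      _ ≤ ∑ i ∈ T, (A₀ + ∑ k, Y k β R (q i) (x' i) (torusLift (2 * L + 1) U)) :=
          Finset.sum_le_sum fun i _ => hsplit β hβ R hR hRa (q i) (x' i) (hq i) _
      _ = A₀ * T.card + ∑ k, Z k U := by
          rw [Finset.sum_add_distrib, Finset.sum_const, nsmul_eq_mul, Finset.sum_comm]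
          ring
  -- integrate
  have hintR : Integrable (fun U => Real.exp (A₀ * T.card) * Real.exp (∑ k, Z k U))
      (wilsonMeasure (d := 4) (L := 2 * L + 1) r.ρ β) := by
    refine (integrable_of_abs_le (Finset.measurable_sum _ fun k _ => hZm k).exp
      (C := Real.exp (∑ _k : Fin K, ∑ i ∈ T, MY β R (q i) (x' i))) fun U => ?_).const_mul _
    rw [Real.abs_exp]
    exact Real.exp_le_exp.2 (Finset.sum_le_sum fun k _ => (le_abs_self _).trans (hZb k U))
  calc torusE G r β L (fun U => Real.exp (∑ i ∈ T, (R : ℝ) ^ 4 / C₁ *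
          |kerE G r β (fun k => x i k - (R + 1)) (2 * R + 3) U (plane G r (q i) (x i)) - p (q i) β|))
      ≤ ∫ U, Real.exp (A₀ * T.card) * Real.exp (∑ k, Z k U) ∂(wilsonMeasure (d := 4) (L := 2 * L + 1) r.ρ β) := by
        unfold torusE
        exact integral_mono_of_nonneg (ae_of_all _ fun U => (Real.exp_pos _).le) hintR
          (ae_of_all _ fun U => hsplit' U)
    _ = Real.exp (A₀ * T.card) * ∫ U, Real.exp (∑ k, Z k U) ∂(wilsonMeasure (d := 4) (L := 2 * L + 1) r.ρ β) :=
        integral_const_mul _ _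
    _ ≤ Real.exp (A₀ * T.card) * Real.exp (B' * T.card) :=
        mul_le_mul_of_nonneg_left havg (Real.exp_pos _).le
    _ = Real.exp ((A₀ + B') * T.card) := by rw [← Real.exp_add]; ring_nf

/-- **(RM) from a quadratic carrier and a large-field carrier with doubled moments on REDUCED families.**  Carriers `Q`, `LF` (measurable, bounded by
`MY β R q x`); (split) for every exterior against `A₀ + Q + LF`; (EM_Q) `⟨exp(2ΣQ_i∘lift)⟩ ≤ e^{B_Q·#T}` on every odd torus and separated family; (EM_LF)
`⟨exp(2ΣLF_i∘lift)⟩ ≤ e^{B_LF·#T}` on every odd torus and separated REDUCED family (`|x i c| ≤ L`).  THEN (RM) for all families with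
`B = A₀ + max(B_Q, B_LF)`. [folklore] -/
theorem responseMoments_of_quadratic_and_reducedLF {C₁ β₁ ℓ₁ A₀ B_Q B_LF : ℝ} {p : Fin 4 × Fin 4 → ℝ → ℝ}
    (Q LF : ℝ → ℕ → Fin 4 × Fin 4 → (Fin 4 → ℤ) → LGConfig 4 G → ℝ) (MY : ℝ → ℕ → Fin 4 × Fin 4 → (Fin 4 → ℤ) → ℝ)
    (hQm : ∀ β R q x, Measurable (Q β R q x)) (hQb : ∀ β R q x η, |Q β R q x η| ≤ MY β R q x)
    (hLFm : ∀ β R q x, Measurable (LF β R q x)) (hLFb : ∀ β R q x η, |LF β R q x η| ≤ MY β R q x)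
    (hsplit : ∀ β : ℝ, β₁ ≤ β → ∀ R : ℕ, 1 ≤ R → (R : ℝ) * a β ≤ ℓ₁ →
      ∀ (q : Fin 4 × Fin 4) (x : Fin 4 → ℤ), q.1 < q.2 → ∀ η : LGConfig 4 G,
        (R : ℝ) ^ 4 / C₁ * |kerE G r β (fun k => x k - (R + 1)) (2 * R + 3) η (plane G r q x) - p q β| ≤
          A₀ + Q β R q x η + LF β R q x η)
    (hEMQ : ∀ β : ℝ, β₁ ≤ β → ∀ (L n : ℕ) (q : Fin n → Fin 4 × Fin 4) (x : Fin n → (Fin 4 → ℤ)) (R : ℕ),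
      (∀ i, (q i).1 < (q i).2) → 1 ≤ R → (R : ℝ) * a β ≤ ℓ₁ → 4 * R + 8 ≤ L →
      (∀ i j : Fin n, i ≠ j → ∃ k : Fin 4,
        (2 * (R : ℤ) + 4) ≤ |((((x i k - x j k : ℤ) : ZMod (2 * L + 1))).valMinAbs : ℤ)|) →
      ∀ T : Finset (Fin n),
        torusE G r β L (fun U => Real.exp (((2 : ℕ) : ℝ) * ∑ i ∈ T, Q β R (q i) (x i) U)) ≤ Real.exp (B_Q * T.card))
    (hEMLF : ∀ β : ℝ, β₁ ≤ β → ∀ (L n : ℕ) (q : Fin n → Fin 4 × Fin 4) (x : Fin n → (Fin 4 → ℤ)) (R : ℕ),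
      (∀ i, (q i).1 < (q i).2) → 1 ≤ R → (R : ℝ) * a β ≤ ℓ₁ → 4 * R + 8 ≤ L →
      (∀ i c, |x i c| ≤ (L : ℤ)) →
      (∀ i j : Fin n, i ≠ j → ∃ k : Fin 4,
        (2 * (R : ℤ) + 4) ≤ |((((x i k - x j k : ℤ) : ZMod (2 * L + 1))).valMinAbs : ℤ)|) →
      ∀ T : Finset (Fin n),
        torusE G r β L (fun U => Real.exp (((2 : ℕ) : ℝ) * ∑ i ∈ T, LF β R (q i) (x i) U)) ≤ Real.exp (B_LF * T.card)) :
    ∀ β : ℝ, β₁ ≤ β → ∀ (L n : ℕ) (q : Fin n → Fin 4 × Fin 4) (x : Fin n → (Fin 4 → ℤ)) (R : ℕ),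
      (∀ i, (q i).1 < (q i).2) → 1 ≤ R → (R : ℝ) * a β ≤ ℓ₁ → 4 * R + 8 ≤ L →
      (∀ i j : Fin n, i ≠ j → ∃ k : Fin 4,
        (2 * (R : ℤ) + 4) ≤ |((((x i k - x j k : ℤ) : ZMod (2 * L + 1))).valMinAbs : ℤ)|) →
      ∀ T : Finset (Fin n),
        torusE G r β L (fun U => Real.exp (∑ i ∈ T, (R : ℝ) ^ 4 / C₁ *
          |kerE G r β (fun k => x i k - (R + 1)) (2 * R + 3) U (plane G r (q i) (x i)) - p (q i) β|)) ≤
          Real.exp ((A₀ + max B_Q B_LF) * T.card) := by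
  set Y : Fin 2 → ℝ → ℕ → Fin 4 × Fin 4 → (Fin 4 → ℤ) → LGConfig 4 G → ℝ := ![Q, LF] with hYdef
  refine responseMoments_of_carriers_local_reduced r a (K := 2) (by norm_num) Y MY ?_ ?_ ?_ ?_
  · intro k β R q x
    fin_cases k
    · simpa [hYdef] using hQm β R q x
    · simpa [hYdef] using hLFm β R q x
  · intro k β R q x η
    fin_cases k
    · simpa [hYdef] using hQb β R q x η
    · simpa [hYdef] using hLFb β R q x η
  · intro β hβ R hR hRa q x hq η
    have h := hsplit β hβ R hR hRa q x hq η
    simpa [hYdef, Fin.sum_univ_two, add_assoc] using h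
  · intro k β hβ L n q x R hq hR hRa hRL hred hsep T
    fin_cases k
    · have h := hEMQ β hβ L n q x R hq hR hRa hRL hsep T
      refine (le_of_eq ?_).trans (h.trans (Real.exp_le_exp.2 ?_))
      · simp [hYdef]
      · exact mul_le_mul_of_nonneg_right (le_max_left _ _) (Nat.cast_nonneg _)
    · have h := hEMLF β hβ L n q x R hq hR hRa hRL hred hsep T
      refine (le_of_eq ?_).trans (h.trans (Real.exp_le_exp.2 ?_))
      · simp [hYdef]
      · exact mul_le_mul_of_nonneg_right (le_max_right _ _) (Nat.cast_nonneg _)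

end Engine

end Summit.QuantumFields.YangMills.Cruxes.UVSeamRec.TemperedResponse

end
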